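import Summits.Ventures.QEC.Thresholds.ToricCodeThresholdFisherSykes
import Literature.Probability.RandomPlanarGeometry.SAWFiniteMemoryKernelK8
import HarnessLib

/-!
# Toric-code thresholds from the KERNEL-checked memory-8 bound `μ(ℤ²) ≤ 2.7445`:
# `p_c > .0343` (perfect measurement) and loss threshold `y_c > .3643`, unconditional
# (LADDER-QEC Q5, certified column, tier CERTIFIED/kernel)

Venture QEC, `Summits/Ventures/QEC/Thresholds/` (continues `ToricCodeThresholdFisherSykes.lean`).
The Pönitz–Tittmann memory-8 certificate for `ℤ²` is now checked BY THE KERNEL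
(`Literature/Probability/RandomPlanarGeometry/SAWFiniteMemoryKernelK8.lean`:
`SAW.Zd.connectiveConstant_two_le_27445 : μ(ℤ²) ≤ 2.7445`, axioms `propext`/`Classical.choice`/
`Quot.sound` — Pönitz–Tittmann 2000 Table 2, `d = 2`, `k = 8`), so the unconditional DKLP theorem
`toricThreshold_connectiveConstant_le` (qec-type-09 / qec-lit-2) yields, with STANDARD axioms:

| theorem | statement | tier |
|---|---|---|
| `toricThreshold_kernelK8` | perfect measurement: threshold `≥ p₀(2.7445)` for every min-weight decoder family | CERTIFIED (kernel), unconditional |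
| `thresholdValue_27445_bounds` | `.0343 < p₀(2.7445) < .0344` | kernel arithmetic |
| `toricThreshold_0343`, `accuracyThreshold_gt_0343`, `hasThreshold_toric_0343`, `ToricCode.accuracyThreshold_minWeight_gt_0343` | **`p_c > .0343`** (kernel decimals so far: `.0286`, `.0293`, `.0322`) | CERTIFIED (kernel), unconditional |
| `toric_decaysExponentially_0343`, `ToricCode.decaysExponentially_minWeight_0343` | exponential decay in `L` at every `p ≤ .0343` | CERTIFIED (kernel), unconditional |
| `lossThreshold_kernelK8`, `loss_accuracyThreshold_gt_0364`, `lossDecoderThreshold_kernelK8` | LOSS channel: `y_c ≥ 1/2.7445 > .3643` | CERTIFIED (kernel), unconditional |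

The CHECKED-native value `.0358` (`μ ≤ 2.688`, `native_decide`) and the CONDITIONAL `.0361`
(Pönitz–Tittmann `k = 18` lower/upper fact of BDGS2012) remain the better decimals at their tiers.
NOT A THEOREM ANYWHERE: DKLP's printed `.0373` (numerical `μ₂ ≈ 2.638`, CLAIM). Theorem-only file.

## References

* [DennisEtAl2002] E. Dennis, A. Kitaev, A. Landahl, J. Preskill, J. Math. Phys. 43 (2002) 4452,
  arXiv:quant-ph/0110143, §5.3 eqs. (saw_2), (threshold_2d)–(p_c_2d), (fail_2d).
* [PonitzTittmann2000] A. Pönitz, P. Tittmann, Electron. J. Combin. 7 (2000) R21, Table 2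
  (`d = 2`, `k = 8`: `μ ≤ 2.7445`).
* [DumerKovalevPryadko2015] I. Dumer, A. A. Kovalev, L. P. Pryadko, PRL 115 (2015) 050502, p. 5.
-/

noncomputable section

namespace Summit.Ventures.QEC.Thresholds

open Filter Topology Finset
open Literature.InformationTheory.QuantumCodes
open Literature.InformationTheory.QuantumCodes.ToricCode
open Literature.Probability.RandomPlanarGeometry

/-! ### Perfect syndrome measurement: `p_c > .0343` (kernel, unconditional) -/

/-- **Toric-code threshold `≥ p₀(2.7445)`, UNCONDITIONAL, tier CERTIFIED (kernel)**, for every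
minimum-weight decoder family (independent bit-flip noise, perfect syndrome measurement), from the
kernel-checked memory-8 bound `μ(ℤ²) ≤ 2.7445`. [cite: DennisEtAl2002, §5.3 eqs. (saw_2), (threshold_2d)] -/
theorem toricThreshold_kernelK8 {D : (L : ℕ) → ZDecoder (L + 1)}
    (hD : ∀ L, (D L).IsMinWeight (syn (L + 1)) (cycles (L + 1)) hammingNorm) :
    IsThresholdLowerBound (toricFailureFamily D) (thresholdValue 2.7445) :=
  toricThreshold_connectiveConstant_le (by norm_num) SAW.Zd.connectiveConstant_two_le_27445 hD

/-- Decimal certificate: `.0343 < p₀(2.7445) < .0344`. [cite: DennisEtAl2002, §5.3 eq. (p_c_2d)] -/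
theorem thresholdValue_27445_bounds :
    (0.0343 : ℝ) < thresholdValue 2.7445 ∧ thresholdValue 2.7445 < 0.0344 := by
  unfold thresholdValue
  constructor
  · have : Real.sqrt (1 - 1 / (2.7445 : ℝ) ^ 2) < 0.9314 := by
      rw [Real.sqrt_lt' (by norm_num)]
      norm_num
    linarith
  · have : (0.9312 : ℝ) < Real.sqrt (1 - 1 / (2.7445 : ℝ) ^ 2) := by
      rw [Real.lt_sqrt (by norm_num)]
      norm_num
    linarith

/-- Decimal form: **every `0 ≤ p < .0343` is below threshold** for every minimum-weight decoder
family of the toric codes (perfect measurement) — UNCONDITIONAL, tier CERTIFIED (kernel).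
[cite: DennisEtAl2002, §4.3 and §5.3 eq. (threshold_2d)] -/
theorem toricThreshold_0343 {D : (L : ℕ) → ZDecoder (L + 1)}
    (hD : ∀ L, (D L).IsMinWeight (syn (L + 1)) (cycles (L + 1)) hammingNorm) :
    IsThresholdLowerBound (toricFailureFamily D) 0.0343 :=
  (toricThreshold_kernelK8 hD).anti thresholdValue_27445_bounds.1.le

/-- **`p_c > .0343`** for every minimum-weight decoder family of the toric codes (perfect
measurement) — UNCONDITIONAL, tier CERTIFIED (kernel). [cite: DennisEtAl2002, §5.3 eq. (p_c_2d)] -/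
theorem accuracyThreshold_gt_0343 {D : (L : ℕ) → ZDecoder (L + 1)}
    (hD : ∀ L, (D L).IsMinWeight (syn (L + 1)) (cycles (L + 1)) hammingNorm) :
    (0.0343 : ℝ) < accuracyThreshold (toricFailureFamily D) :=
  lt_of_lt_of_le thresholdValue_27445_bounds.1
    (le_accuracyThreshold (toricThreshold_kernelK8 hD) ((thresholdValue_le_half _).trans (by norm_num)))

/-- The canonical minimum-weight decoders `Decoder.minWeight`: `p_c > .0343` — UNCONDITIONAL,
tier CERTIFIED (kernel). [cite: DennisEtAl2002, §5.3 eq. (p_c_2d)] -/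
theorem ToricCode.accuracyThreshold_minWeight_gt_0343 :
    (0.0343 : ℝ) < accuracyThreshold
      (toricFailureFamily fun L => Decoder.minWeight (syn (L + 1)) hammingNorm) :=
  accuracyThreshold_gt_0343 fun L => ToricCode.isMinWeight_minWeight (L + 1)

/-- `HasThreshold` (PARTITION row-09 vocabulary) at `p₀(2.7445) > .0343` for every minimum-weight
decoder family — UNCONDITIONAL, tier CERTIFIED (kernel). [cite: DennisEtAl2002, §4.3 and §5.3 eq. (threshold_2d)] -/
theorem hasThreshold_toric_kernelK8 {D : (L : ℕ) → ZDecoder (L + 1)}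
    (hD : ∀ L, (D L).IsMinWeight (syn (L + 1)) (cycles (L + 1)) hammingNorm) :
    HasThreshold (fun L p => (D L).logicalFailureProb (syn (L + 1)) (boundaries (L + 1))
      (iidLaw (bitLaw (min p.toNNReal 1) (min_le_right _ _)))) (thresholdValue 2.7445) :=
  hasThreshold_of_isThresholdLowerBound (toricThreshold_kernelK8 hD)
    ((thresholdValue_le_half _).trans (by norm_num))

/-- `HasThreshold` at the decimal `.0343` for every minimum-weight decoder family — UNCONDITIONAL.
[cite: DennisEtAl2002, §5.3 eq. (p_c_2d)] -/
theorem hasThreshold_toric_0343 {D : (L : ℕ) → ZDecoder (L + 1)}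
    (hD : ∀ L, (D L).IsMinWeight (syn (L + 1)) (cycles (L + 1)) hammingNorm) :
    HasThreshold (fun L p => (D L).logicalFailureProb (syn (L + 1)) (boundaries (L + 1))
      (iidLaw (bitLaw (min p.toNNReal 1) (min_le_right _ _)))) 0.0343 :=
  hasThreshold_of_isThresholdLowerBound (toricThreshold_0343 hD) (by norm_num)

/-- **Exponential decay below `p₀(2.7445)`, UNCONDITIONAL, kernel**, for every minimum-weight
decoder family (a walk-count constant at `ν = 2.745 > μ(ℤ²)` exists; every `p < p₀(2.7445)` is below
`p₀(ν')` for some `ν' ∈ (2.7445, 2.745]` — we use the weaker `p ≤ .0343 < p₀(2.745)`).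
[cite: DennisEtAl2002, §5.3 eq. (fail_2d)] -/
theorem toric_decaysExponentially_0343 {D : (L : ℕ) → ZDecoder (L + 1)}
    (hD : ∀ L, (D L).IsMinWeight (syn (L + 1)) (cycles (L + 1)) hammingNorm) {p : ℝ}
    (hp₀ : 0 ≤ p) (hpp : p ≤ 0.0343) :
    DecaysExponentially (toricFailureFamily D) p := by
  have hlt : SAW.Zd.connectiveConstant 2 < 2.745 :=
    lt_of_le_of_lt SAW.Zd.connectiveConstant_two_le_27445 (by norm_num)
  obtain ⟨C, hC⟩ := exists_sawCountBound_of_connectiveConstant_lt hlt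
  have hval : (0.0343 : ℝ) < thresholdValue 2.745 := by
    unfold thresholdValue
    have : Real.sqrt (1 - 1 / (2.745 : ℝ) ^ 2) < 0.9314 := by
      rw [Real.sqrt_lt' (by norm_num)]
      norm_num
    linarith
  exact toric_decaysExponentially_sawCountBound (by norm_num) hC hD hp₀ (lt_of_le_of_lt hpp hval)

/-- The canonical minimum-weight decoders: exponential decay at every `0 ≤ p ≤ .0343` —
UNCONDITIONAL, kernel. [cite: DennisEtAl2002, §5.3 eq. (fail_2d)] -/
theorem ToricCode.decaysExponentially_minWeight_0343 {p : ℝ} (hp₀ : 0 ≤ p) (hpp : p ≤ 0.0343) :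
    DecaysExponentially (toricFailureFamily fun L => Decoder.minWeight (syn (L + 1)) hammingNorm) p :=
  toric_decaysExponentially_0343 (fun L => ToricCode.isMinWeight_minWeight (L + 1)) hp₀ hpp

/-! ### The loss (erasure) channel: `y_c > .3643` (kernel, unconditional) -/

/-- **Loss threshold of the toric code `≥ 1/2.7445`** — UNCONDITIONAL, tier CERTIFIED (kernel)
(`y_c ≥ 1/μ(ℤ²)` of qec-lit-2 with the kernel memory-8 bound).
[cite: DumerKovalevPryadko2015, p. 5 (toric erasure threshold)] -/
theorem lossThreshold_kernelK8 : IsThresholdLowerBound erasureFamily (1 / 2.7445) := by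
  refine lossThreshold_inv_connectiveConstant.anti ?_
  have h0 : 0 < SAW.Zd.connectiveConstant 2 := lt_of_lt_of_le one_pos (SAW.Zd.one_le_connectiveConstant 2)
  exact one_div_le_one_div_of_le h0 SAW.Zd.connectiveConstant_two_le_27445

/-- Decimal certificate: `.3643 < 1/2.7445`. [cite: DumerKovalevPryadko2015, p. 5] -/
theorem one_div_27445_gt : (0.3643 : ℝ) < 1 / 2.7445 := by norm_num

/-- **`y_c > .3643`** for the toric code under the loss channel — UNCONDITIONAL, tier CERTIFIED
(kernel). [cite: DumerKovalevPryadko2015, p. 5] -/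
theorem loss_accuracyThreshold_gt_0364 : (0.3643 : ℝ) < accuracyThreshold erasureFamily :=
  lt_of_lt_of_le one_div_27445_gt (le_accuracyThreshold lossThreshold_kernelK8 (by norm_num))

/-- For EVERY family of consistent loss decoders of the toric codes: loss threshold `≥ 1/2.745`
(`> .3642`) — UNCONDITIONAL, tier CERTIFIED (kernel) (explicit walk-count constant at
`ν = 2.745 > μ(ℤ²)`). [cite: DumerKovalevPryadko2015, p. 5] -/
theorem lossDecoderThreshold_kernelK8 (D : (L : ℕ) → ErasureDecoder (Edge (L + 1)) (Syndrome (L + 1)))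
    (hD : ∀ L, (D L).IsConsistent (syn (L + 1)) (cycles (L + 1))) :
    IsThresholdLowerBound (fun L y => (D L).failureProb (syn (L + 1)) (boundaries (L + 1)) y)
      (1 / 2.745) := by
  have hlt : SAW.Zd.connectiveConstant 2 < 2.745 :=
    lt_of_le_of_lt SAW.Zd.connectiveConstant_two_le_27445 (by norm_num)
  obtain ⟨C, hC⟩ := exists_sawCountBound_of_connectiveConstant_lt hlt
  exact erasureDecoderThreshold_of_sawCountBound (by norm_num) hC D hD

end Summit.Ventures.QEC.Thresholds

end
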